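import Mathlib
import Summits.KontsevichZagierPeriods.KontsevichZagierPeriods.Theses.SymplecticScissors
import Summits.KontsevichZagierPeriods.KontsevichZagierPeriods.Theorems.SymplecticScissorsVolumeFormPerspectiveMap
import Summits.KontsevichZagierPeriods.KontsevichZagierPeriods.Theorems.SymplecticScissorsVolumeFormStackReduction
import Literature.NumberTheory.Transcendental.KZCalculusProofs
import Literature.NumberTheory.Transcendental.SemialgebraicMapsProofs
import Literature.NumberTheory.Transcendental.KZSemiCanonicalReductionProofs

/-!
# `VolumeForm` (stmt-KontsevichZagierPeriods-3814), line `Sketch` — stub `stub_coneFlatten`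

**Flattening a cone over an arbitrary base (every dimension).** For a base `K ⊆ ℝⁿ⁺¹` with
integrand `1` (hence of finite volume) the open cone `C = {(t·u, t) | u ∈ K, 0 < t < 1} ⊆ ℝⁿ⁺²`
with integrand `1` is KZ-equivalent to the copy `K' = {u | ((n + 2) u₀, u₁, …, u_n) ∈ K}` of `K`
squeezed by `1 / (n + 2)` in the coordinate `0` (so `vol K' = vol K / (n + 2) = vol C`), and `K'`
exists as a representation. The moves:
(2) the landed perspective map `stub_perspectiveMap` carries `C` onto the open flat subgraph
`F = K × (0, 1 / (n + 2))`;
(1) `F` differs from the closed band `G = K × [0, 1 / (n + 2)]` by two null hyperplanes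
(`KZ.of_sub_of_mem_relations_of_null`);
(3) `G` is one Newton–Leibniz move above the base `K'' = [K, 1 / (n + 2)]` (the region under the
graph of a constant, `KZ.exists_underGraph`);
(2) the linear stretch `L u = ((n + 2) u₀, u₁, …, u_n)`, `det L = n + 2`, is one change of variables
from `K' = [L⁻¹ K, 1]` onto `K'' = [K, 1 / (n + 2)]` (`1 = (1 / (n + 2)) · |n + 2|`); the volume of
`L⁻¹ K` is `vol K / (n + 2) < ∞` (`MeasureTheory.Measure.addHaar_preimage_continuousLinearMap`).
Sources: M. Kontsevich, D. Zagier, *Periods* (2001), §1.2 rules (1)–(3); the cone-over-a-base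
computation is Archimedes/Democritus folklore, the rest is calculus bookkeeping.
-/

noncomputable section

open Set MeasureTheory MvPolynomial
open Literature.NumberTheory.Transcendental
open Literature.ModelTheory.ExponentialFields (IsSemialgebraic)

namespace Summit.KontsevichZagierPeriods.SymplecticScissors.VolumeForm

/-- The coordinate stretch `u ↦ (c u₀, u₁, …, u_m)` of `ℝ^{m+1}` is a continuous linear map of
determinant `c` (a diagonal matrix). [folklore] -/
theorem coneFlat_exists_clm (m : ℕ) (c : ℝ) :
    ∃ L : (Fin (m + 1) → ℝ) →L[ℝ] (Fin (m + 1) → ℝ),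
      (∀ u, L u = Function.update u 0 (c * u 0)) ∧ L.det = c := by
  refine ⟨ContinuousLinearMap.pi fun i =>
      (ContinuousLinearMap.toSpanSingleton ℝ (if i = 0 then c else 1)).comp
        (ContinuousLinearMap.proj i), fun u => ?_, ?_⟩
  · funext j
    simp only [ContinuousLinearMap.pi_apply, ContinuousLinearMap.coe_comp, Function.comp_apply,
      ContinuousLinearMap.proj_apply, ContinuousLinearMap.toSpanSingleton_apply, smul_eq_mul]
    rcases eq_or_ne j 0 with rfl | hj
    · rw [if_pos rfl, Function.update_self, mul_comm]
    · rw [if_neg hj, Function.update_of_ne hj, mul_one]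
  · rw [ContinuousLinearMap.det_pi]
    simp

/-- **Flattening a cone** (stub `stub_coneFlatten` of `VolumeForm`, line `Sketch`,
stmt-KontsevichZagierPeriods-3814). For a representation `K` of dimension `n + 1` with integrand
`1` and a representation `C` of dimension `n + 2` with integrand `1` on the open cone
`{p | 0 < p_{n+1} < 1, p' / p_{n+1} ∈ K}` over `K`, there is a representation `K'` with integrand
`1` on the squeezed base `{u | ((n + 2) u₀, u₁, …, u_n) ∈ K}`, and `C` is KZ-equivalent to `K'`:
perspective map (rule (2)), two null hyperplanes (rule (1)), the region under a constant graph
(rule (3)) and a diagonal linear change of variables (rule (2)).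
[cite: KontsevichZagier2001, §1.2 rules (1)–(3)] -/
theorem stub_coneFlatten : ∀ (n : ℕ) (K : KZ.IntegralRep (n + 1)) (C : KZ.IntegralRep (n + 2)),
    (∀ x ∈ K.domain, K.integrand x = 1) →
    C.domain = {p | 0 < p (Fin.last (n + 1)) ∧
      (fun i : Fin (n + 1) => p (Fin.castSucc i) / p (Fin.last (n + 1))) ∈ K.domain ∧
      p (Fin.last (n + 1)) < 1} →
    (∀ p ∈ C.domain, C.integrand p = 1) →
    ∃ K' : KZ.IntegralRep (n + 1),
      K'.domain = {u | Function.update u 0 (((n : ℝ) + 2) * u 0) ∈ K.domain} ∧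
      (∀ u ∈ K'.domain, K'.integrand u = 1) ∧ KZ.Equivalent C K' := by
  intro n K C hK hC hCi
  have hn2 : (0 : ℝ) < (n : ℝ) + 2 := by positivity
  -- the height of the flat subgraph, in the format produced by `stub_perspectiveMap`
  set B : ℝ := (1 : ℝ) ^ (n + 1 + 1) / (((n + 1 : ℕ) : ℝ) + 1) with hB_def
  have hBq : B = ((1 / ((n : ℚ) + 2) : ℚ) : ℝ) := by
    rw [hB_def, one_pow]
    push_cast
    ring
  have hB0 : 0 < B := by
    rw [hB_def]
    positivity
  -- the base has finite volume
  have hKint : IntegrableOn (fun _ => (1 : ℝ)) K.domain :=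
    K.integrableOn.congr_fun (fun x hx => hK x hx) (KZ.IntegralRep.measurableSet_domain_holds K)
  have hKvol : volume K.domain < ⊤ :=
    ((integrableOn_const_iff (by simp)).1 hKint).resolve_left (by simp)
  -- `K'' = [K, B]`: the base with the constant integrand `B = 1 / (n + 2)`
  obtain ⟨K'', hK''d, hK''i⟩ : ∃ K'' : KZ.IntegralRep (n + 1), K''.domain = K.domain ∧
      K''.integrand = fun _ => B :=
    ⟨⟨K.domain, fun _ => B, K.isSemialgebraic_domain,
      (isSemialgebraicFunOn_ratCast K.isSemialgebraic_domain (1 / ((n : ℚ) + 2))).congr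
        fun _ _ => hBq.symm, integrableOn_const hKvol.ne⟩, rfl, rfl⟩
  -- `G = [K × [0, B], 1]`: the region under the constant graph, one Newton–Leibniz move (rule (3))
  -- above `K''`
  obtain ⟨G, hGd, hGi, hGNL⟩ := KZ.exists_underGraph K'' fun _ _ => by rw [hK''i]; exact hB0.le
  have hGmem : ∀ q, q ∈ G.domain ↔
      Fin.init q ∈ K.domain ∧ 0 ≤ q (Fin.last (n + 1)) ∧ q (Fin.last (n + 1)) ≤ B := fun q => by
    rw [hGd, KZlog.mem_band, hK''d, hK''i]
  have hGvol : volume G.domain < ⊤ := by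
    have h := G.integrableOn
    rw [hGi] at h
    exact ((integrableOn_const_iff (by simp)).1 h).resolve_left (by simp)
  -- `F = [K × (0, B), 1]`: the open flat subgraph
  set Fdom : Set (Fin (n + 1 + 1) → ℝ) :=
    {q | Fin.init q ∈ K.domain ∧ 0 < q (Fin.last (n + 1)) ∧ q (Fin.last (n + 1)) < B} with hFdom
  have hFG : Fdom ⊆ G.domain := fun q hq => (hGmem q).2 ⟨hq.1, hq.2.1.le, hq.2.2.le⟩
  have hFsa : IsSemialgebraic ℚ Fdom := by
    have h1 : IsSemialgebraic ℚ {q : Fin (n + 1 + 1) → ℝ | 0 < q (Fin.last (n + 1))} := by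
      simpa using Literature.ModelTheory.ExponentialFields.isSemialgebraic_setOf_eval_pos (k := ℚ)
        (R := ℝ) (X (Fin.last (n + 1)) : MvPolynomial (Fin (n + 1 + 1)) ℚ)
    have h2 : IsSemialgebraic ℚ {q : Fin (n + 1 + 1) → ℝ | q (Fin.last (n + 1)) < B} := by
      rw [hBq]
      simpa using Literature.ModelTheory.ExponentialFields.isSemialgebraic_setOf_eval_lt (k := ℚ)
        (R := ℝ) (X (Fin.last (n + 1)) : MvPolynomial (Fin (n + 1 + 1)) ℚ)
        (MvPolynomial.C (1 / ((n : ℚ) + 2)))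
    convert (K.isSemialgebraic_domain.setOf_init_mem.inter h1).inter h2 using 1
    ext q
    simp only [hFdom, mem_setOf_eq, mem_inter_iff, and_assoc]
  have hFfin : volume Fdom ≠ ⊤ := ((measure_mono hFG).trans_lt hGvol).ne
  obtain ⟨F, hFd, hFi⟩ := KZ.exists_oneRep hFsa hFfin
  -- rule (2): the perspective map, `[C] − [F]`
  have h1sa : IsSemialgebraicFunOn ℚ K.domain fun _ => (1 : ℝ) := by
    simpa using isSemialgebraicFunOn_ratCast K.isSemialgebraic_domain 1
  have e1 : KZ.of C - KZ.of F ∈ KZ.relations :=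
    KZ.changeOfVariablesRel_subset_relations (stub_perspectiveMap (n + 1) K.domain (fun _ => 1) C F
      K.isSemialgebraic_domain h1sa (fun _ _ => one_pos) hC hFd hCi fun q _ => by rw [hFi])
  -- rule (1): `F` and `G` differ by the two null hyperplanes `{q_{n+1} = 0}`, `{q_{n+1} = B}`
  have e2 : KZ.of F - KZ.of G ∈ KZ.relations := by
    refine KZ.of_sub_of_mem_relations_of_null F G ?_ ?_ fun q _ => by rw [hFi, hGi]
    · rw [hFd, sdiff_eq_empty.2 hFG, measure_empty]
    · refine measure_mono_null (fun q hq => ?_) (measure_union_null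
        (KZ.volume_setOf_last_eq_zero (n := n + 1) 0) (KZ.volume_setOf_last_eq_zero (n := n + 1) B))
      rw [mem_sdiff, hGmem, hFd] at hq
      obtain ⟨⟨hqK, h0, h1⟩, hqF⟩ := hq
      simp only [mem_union, mem_setOf_eq]
      by_contra hne
      obtain ⟨hne0, hne1⟩ := not_or.1 hne
      exact hqF ⟨hqK, lt_of_le_of_ne h0 (Ne.symm hne0), lt_of_le_of_ne h1 hne1⟩
  -- rule (3): `[G] − [K'']`
  have e3 : KZ.of G - KZ.of K'' ∈ KZ.relations := KZ.newtonLeibnizRel_subset_relations hGNL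
  -- the stretch `L u = ((n + 2) u₀, u₁, …, u_n)`, `det L = n + 2`, and the squeezed base `K'dom`
  obtain ⟨L, hL, hLdet⟩ := coneFlat_exists_clm n ((n : ℝ) + 2)
  have hdet0 : L.det ≠ 0 := by
    rw [hLdet]
    exact hn2.ne'
  have hLbij : Function.Bijective L := (L.toContinuousLinearEquivOfDetNeZero hdet0).bijective
  set K'dom : Set (Fin (n + 1) → ℝ) := {u | Function.update u 0 (((n : ℝ) + 2) * u 0) ∈ K.domain}
    with hK'dom
  have hpre : K'dom = L ⁻¹' K.domain := by
    ext u
    simp only [hK'dom, mem_setOf_eq, mem_preimage, hL]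
  -- `L` is a polynomial map
  let P : Fin (n + 1) → MvPolynomial (Fin (n + 1)) ℚ := fun j =>
    if j = 0 then ((n : MvPolynomial (Fin (n + 1)) ℚ) + 2) * X 0 else X j
  have hP : ∀ u : Fin (n + 1) → ℝ, (fun j => aeval u (P j)) = L u := fun u => by
    rw [hL]
    funext j
    rcases eq_or_ne j 0 with rfl | hj
    · simp [P]
    · simp [P, hj]
  have hK'sa : IsSemialgebraic ℚ K'dom := by
    rw [hpre]
    convert K.isSemialgebraic_domain.preimage_aeval P using 1
    ext u
    simp only [mem_preimage, ← hP]
  have hK'vol : volume K'dom < ⊤ := by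
    rw [hpre, Measure.addHaar_preimage_continuousLinearMap volume hdet0 K.domain]
    exact ENNReal.mul_lt_top ENNReal.ofReal_lt_top hKvol
  obtain ⟨K', hK'd, hK'i⟩ := KZ.exists_oneRep hK'sa hK'vol.ne
  -- rule (2): `[K'] − [K'']` by the linear change of variables `L`
  have e4 : KZ.of K' - KZ.of K'' ∈ KZ.relations := by
    refine KZ.changeOfVariablesRel_subset_relations ⟨n + 1, K', K'', ⇑L, fun _ => L, ?_,
      fun u _ => L.hasFDerivAt.hasFDerivWithinAt, hLbij.1.injOn, ?_, fun u _ => ?_, rfl⟩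
    · rw [hK'd]
      exact (isSemialgebraicMapOn_aeval hK'sa P).congr fun u _ => hP u
    · rw [hK''d, hK'd, hpre, image_preimage_eq _ hLbij.2]
    · rw [hK'i, hK''i]
      show (1 : ℝ) = B * |L.det|
      rw [hLdet, abs_of_pos hn2, hBq]
      push_cast
      rw [div_mul_cancel₀ _ hn2.ne']
  -- assemble the four moves
  refine ⟨K', hK'd, fun u _ => by rw [hK'i], ?_⟩
  show KZ.of C - KZ.of K' ∈ KZ.relations
  have : KZ.of C - KZ.of K' = (KZ.of C - KZ.of F) + (KZ.of F - KZ.of G) + (KZ.of G - KZ.of K'') -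
      (KZ.of K' - KZ.of K'') := by abel
  rw [this]
  exact KZ.relations.sub_mem (KZ.relations.add_mem (KZ.relations.add_mem e1 e2) e3) e4

end Summit.KontsevichZagierPeriods.SymplecticScissors.VolumeForm

end
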